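import Summits.ABC.ABC.Theses.CubicResolventAllowance
import Literature.NumberTheory.NumberFields.CubicFieldExplicit
import Literature.NumberTheory.EllipticCurves.GlobalMinimalModelProofs
import Literature.NumberTheory.DiophantineGeometry.EllArithGlueProofs
import Literature.NumberTheory.EllipticCurves.SzpiroOfAbcProofs
import HarnessLib

/-!
# STUB-IDEAS `stub_complexCubic` · ideator k1 · generation 5 — the keystone identity, BY NAME

Crux stmt-ABC-22740 `CubicResolventAllowance.IndexSzpiro`, stub `stub_complexCubic` (the `d_K < 0` half),
route-ABC-CubicResolventAllowance. FAMILY 1 (recognise & import), gen 5.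

Every sketch of every slot (k1 g2 `H1_disc_ratio_sq`, k2 g2 `H0_index_square`, k3 `Δ_eq_sq_mul_discr` /
`exists_index_sq_eq` / `DiscSqRatio`) has the SAME sorried keystone `Δ(W) = q² · d_K` (integrally
`2⁸ · Δ_min = I² · |d_K|`), and everything marked "VERIFIED modulo H1" downstream (k3 L1/L2 parity and
allowance lemmas, k2 g4 `allowanceDvd` ⇒ `IndexSzpiro_of' : OddTowerSzpiro → AllowanceDvd → IndexSzpiro`)
hangs on it. This file RECOGNISES the keystone as a composition of tree theorems that already exist:

* `Literature.NumberTheory.NumberFields.MonicCubic.pb / discr_pb / isIntegral_pb_gen`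
  (`CubicFieldExplicit.lean`: `disc(1, η, η²) = disc(X³ + aX² + bX + c)`, PROVED) and
* `Literature.NumberTheory.NumberFields.discr_powerBasis_eq_indexDet_sq_mul_discr` + `indexDet_ne_zero`
  (`IntegralBasisCriterion.lean`: `disc(1, η, …) = indexDet² · d_K`, Marcus Ex. 2.27, PROVED),

applied to `η = 4θ'`, `θ'` a root of `ψ₂` of the global minimal model (`hasGlobalMinimalModel_rat_holds`,
`map_integralModelInt`, `minimalDiscriminantNorm_int_eq_natAbs_minimalDiscriminantInt_holds`,
`minimalDiscriminantNorm_smul_rat`, all PROVED), whose monic cubic `X³ + b₂X² + 8b₄X + 16b₆ = 16ψ₂(X/4)`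
has discriminant `2⁸Δ` (k2 g2 `H0b`, VERIFIED; restated here as K2a/K2b).

Result (`lean check` rc 0, ZERO sorries): K4 (the match), K5 (`= k3 exists_index_sq_eq`, verbatim
signature), K6 (`= k3 DiscSqRatio` / k1 g2 H1 / k2 g2 H0, ℚ-form), K7a `discSqRatio : DiscSqRatio` and K7b
(the sign door `d_K < 0 ↔ Δ < 0`) are all PROVED, together with the two polynomial identities they need,
K1i/K1 (root transport under `VariableChange`, the `RealPeriod.eval_twoTorsionPolynomial_variableChange`
pattern over any number field) and K3a/K3 (irreducibility of the monic model cubic via "no rational root").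
So every lemma the three slots marked "VERIFIED modulo H1/H0" (k3 L1 `ordMinDisc_parity`, L2
`dvd_discr_of_odd_ordMinDisc`; k2 g4 `allowanceDvd` given L2; the sign split) becomes sorry-free by
passing `discSqRatio` / `K5_exists_index_sq_eq`. Nothing here touches the Szpiro core (`OddTowerSzpiro`);
the stub itself stays open-problem strength. Scratch namespace; ready to be ported to
`Theorems/` by a prover (`--supports stmt-ABC-22740`).
-/

set_option linter.dupNamespace false

noncomputable section

namespace Summit.ABC.ABC.Cruxes.IndexSzpiro.StubIdeasComplexCubic1G5

open Polynomial
open Literature.NumberTheory.NumberFields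

/-- The stub, verbatim (payload `stub.signature`). -/
def Stub : Prop :=
  ∀ ε : ℝ, 0 < ε → ∃ C : ℝ, ∀ (W : WeierstrassCurve ℚ) [W.IsElliptic] (K : Type) [Field K]
    [NumberField K], Irreducible W.twoTorsionPolynomial.toPoly → Module.finrank ℚ K = 3 →
    (∃ θ : K, aeval θ W.twoTorsionPolynomial.toPoly = 0) → NumberField.discr K < 0 →
    (W.minimalDiscriminantNorm ℤ : ℝ) ≤
      C * |(NumberField.discr K : ℝ)| * (W.conductorNorm ℤ : ℝ) ^ (6 + ε)

/-! ## K1 — root transport under a change of variables (PROVED; = k2 g2 `H0a_root_transport`, there sorried) -/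

/-- **K1i (PROVED).** `ψ_{C • W}(x') = u⁻⁶ · ψ_W(u² x' + r)` over any number field `K`
(pattern and proof = `RealPeriod.eval_twoTorsionPolynomial_variableChange`, which is the case `K = ℝ`). -/
theorem K1i_aeval_twoTorsionPolynomial_smul (W : WeierstrassCurve ℚ)
    (C : WeierstrassCurve.VariableChange ℚ) (K : Type) [Field K] [NumberField K] (x : K) :
    aeval x (C • W).twoTorsionPolynomial.toPoly =
      (algebraMap ℚ K (↑C.u : ℚ))⁻¹ ^ 6 *
        aeval (algebraMap ℚ K (↑C.u : ℚ) ^ 2 * x + algebraMap ℚ K C.r)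
          W.twoTorsionPolynomial.toPoly := by
  have hu : algebraMap ℚ K (↑C.u : ℚ) ≠ 0 := by simp
  simp only [WeierstrassCurve.twoTorsionPolynomial, Cubic.toPoly, map_add, map_mul, map_pow,
    aeval_C, aeval_X, WeierstrassCurve.variableChange_b₂, WeierstrassCurve.variableChange_b₄,
    WeierstrassCurve.variableChange_b₆, Units.val_inv_eq_inv_val, map_inv₀, map_ofNat]
  field_simp
  ring

/-- **K1 (PROVED from K1i).** Root transport: `u⁻²(θ - r)` is a root of `ψ_{C • W}`. -/
theorem K1_root_transport (W : WeierstrassCurve ℚ) (C : WeierstrassCurve.VariableChange ℚ)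
    (K : Type) [Field K] [NumberField K] {θ : K} (hθ : aeval θ W.twoTorsionPolynomial.toPoly = 0) :
    aeval (algebraMap ℚ K ((↑C.u⁻¹ : ℚ) ^ 2) * (θ - algebraMap ℚ K C.r))
      (C • W).twoTorsionPolynomial.toPoly = 0 := by
  have hu : algebraMap ℚ K (↑C.u : ℚ) ≠ 0 := by simp
  rw [K1i_aeval_twoTorsionPolynomial_smul]
  have : algebraMap ℚ K (↑C.u : ℚ) ^ 2 * (algebraMap ℚ K ((↑C.u⁻¹ : ℚ) ^ 2) *
      (θ - algebraMap ℚ K C.r)) + algebraMap ℚ K C.r = θ := by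
    rw [Units.val_inv_eq_inv_val, map_pow, map_inv₀]
    field_simp
    ring
  rw [this, hθ, mul_zero]

/-! ## K2 — the monic model cubic of an integral model (VERIFIED; = k2 g2 `H0b_monic_rescaling`) -/

/-- **K2i (VERIFIED).** `g(4x) = 16·ψ₂(x)` for the monic model cubic `g = X³ + b₂X² + 8b₄X + 16b₆`. -/
theorem K2i_aeval_monic (W₀ : WeierstrassCurve ℤ) (K : Type) [Field K] [NumberField K] (x : K) :
    aeval ((4 : K) * x) (MonicCubic.poly W₀.b₂ (8 * W₀.b₄) (16 * W₀.b₆)) =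
      16 * aeval x (W₀.map (Int.castRingHom ℚ)).twoTorsionPolynomial.toPoly := by
  simp [MonicCubic.poly, WeierstrassCurve.twoTorsionPolynomial, Cubic.toPoly,
    WeierstrassCurve.map_b₂, WeierstrassCurve.map_b₄, WeierstrassCurve.map_b₆, map_ofNat]
  ring

/-- **K2a (VERIFIED).** `4θ'` is a root of the MONIC integer cubic `X³ + b₂X² + 8b₄X + 16b₆ = 16·ψ₂(X/4)`. -/
theorem K2a_monic_root (W₀ : WeierstrassCurve ℤ) (K : Type) [Field K] [NumberField K] {θ' : K}
    (hθ' : aeval θ' (W₀.map (Int.castRingHom ℚ)).twoTorsionPolynomial.toPoly = 0) :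
    aeval ((4 : K) * θ') (MonicCubic.poly W₀.b₂ (8 * W₀.b₄) (16 * W₀.b₆)) = 0 := by
  rw [K2i_aeval_monic, hθ', mul_zero]

/-- **K2b.** `disc(X³ + b₂X² + 8b₄X + 16b₆) = 2⁸ · Δ` (uses only `4b₈ = b₂b₆ - b₄²`). -/
theorem K2b_monic_disc (W₀ : WeierstrassCurve ℤ) :
    MonicCubic.disc W₀.b₂ (8 * W₀.b₄) (16 * W₀.b₆) = 2 ^ 8 * W₀.Δ := by
  simp only [MonicCubic.disc, WeierstrassCurve.Δ, WeierstrassCurve.b₂, WeierstrassCurve.b₄,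
    WeierstrassCurve.b₆, WeierstrassCurve.b₈]
  ring

/-! ## K3 — irreducibility of the monic model cubic WITHOUT a composition lemma (PROVED; = k2 g2 `H0c`, there sorried) -/

/-- **K3a (PROVED).** A rational root `q` of the monic model cubic of `W₀` with `W₀ ⊗ ℚ = C • W` gives the
rational root `u²·(q/4) + r` of `ψ_W` (the inverse substitution of K1; pure computation). -/
theorem K3a_rat_root_back (W : WeierstrassCurve ℚ) (C : WeierstrassCurve.VariableChange ℚ)
    (W₀ : WeierstrassCurve ℤ) (hC : W₀.map (Int.castRingHom ℚ) = C • W) (q : ℚ)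
    (hq : aeval q (MonicCubic.polyQ W₀.b₂ (8 * W₀.b₄) (16 * W₀.b₆)) = 0) :
    aeval ((↑C.u : ℚ) ^ 2 * (q / 4) + C.r) W.twoTorsionPolynomial.toPoly = 0 := by
  have hu : (↑C.u : ℚ) ≠ 0 := C.u.ne_zero
  -- over `K = ℚ` the lemmas K1i/K2i carry the `DivisionRing.toRatAlgebra` instance; the goal carries
  -- `Algebra.id`; `convert` bridges the (subsingleton) instance gap at the end.
  have hA := K2i_aeval_monic W₀ ℚ (q / 4)
  rw [show (4 : ℚ) * (q / 4) = q by ring] at hA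
  have hq0 : aeval q (MonicCubic.poly W₀.b₂ (8 * W₀.b₄) (16 * W₀.b₆)) = 0 := by
    rw [MonicCubic.polyQ, Polynomial.aeval_map_algebraMap] at hq; exact hq
  have h16 := (mul_eq_zero.mp (hA.symm.trans hq0)).resolve_left (by norm_num)
  have hB := K1i_aeval_twoTorsionPolynomial_smul W C ℚ (q / 4)
  rw [← hC, h16] at hB
  have hu' : (algebraMap ℚ ℚ (↑C.u : ℚ)) ≠ 0 := by simp
  have hroot := (mul_eq_zero.mp hB.symm).resolve_left (pow_ne_zero _ (inv_ne_zero hu'))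
  convert hroot using 3
  all_goals rfl

/-- **K3 (PROVED from K3a).** The monic model cubic is irreducible over `ℚ`: a cubic is irreducible iff it
has no root (`Polynomial.irreducible_of_degree_le_three_of_not_isRoot`), and a rational root would give
one of `ψ_W` (K3a), contradicting `Irreducible ψ_W` (`degree_eq_one_of_irreducible_of_root`, degree `3`). -/
theorem K3_monic_irreducible (W : WeierstrassCurve ℚ) (C : WeierstrassCurve.VariableChange ℚ)
    (W₀ : WeierstrassCurve ℤ) (hC : W₀.map (Int.castRingHom ℚ) = C • W)
    (hirr : Irreducible W.twoTorsionPolynomial.toPoly) :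
    Irreducible (MonicCubic.polyQ W₀.b₂ (8 * W₀.b₄) (16 * W₀.b₆)) := by
  refine Polynomial.irreducible_of_degree_le_three_of_not_isRoot
    (by rw [MonicCubic.natDegree_polyQ]; decide) fun q hq => ?_
  have hq' : aeval q (MonicCubic.polyQ W₀.b₂ (8 * W₀.b₄) (16 * W₀.b₆)) = 0 := by
    rw [Polynomial.coe_aeval_eq_eval]; exact hq
  have hroot := K3a_rat_root_back W C W₀ hC q hq'
  have h1 := Polynomial.degree_eq_one_of_irreducible_of_root hirr
    (show IsRoot W.twoTorsionPolynomial.toPoly _ by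
      rw [Polynomial.IsRoot.def, ← Polynomial.coe_aeval_eq_eval]; exact hroot)
  have h3 : W.twoTorsionPolynomial.toPoly.natDegree = 3 :=
    Cubic.natDegree_of_a_ne_zero (by norm_num [WeierstrassCurve.twoTorsionPolynomial])
  rw [Polynomial.degree_eq_natDegree hirr.ne_zero, h3] at h1
  exact absurd h1 (by decide)

/-! ## K4 — THE MATCH: `2⁸ Δ(W₀) = indexDet² · d_K` is two tree theorems (S, PROVED) -/

/-- **K4 (S, PROVED).** For an integral model `W₀` and `η ∈ K` a root of its monic model cubic
(irreducible, `[K:ℚ] = 3`): `2⁸ · Δ(W₀) = I² · d_K` with `I = indexDet ≠ 0` the index `[𝓞_K : ℤ[η]]`.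
`MonicCubic.discr_pb` ∘ `discr_powerBasis_eq_indexDet_sq_mul_discr` ∘ K2b. -/
theorem K4_index_sq_int (W₀ : WeierstrassCurve ℤ) (K : Type) [Field K] [NumberField K] {η : K}
    (hirr : Irreducible (MonicCubic.polyQ W₀.b₂ (8 * W₀.b₄) (16 * W₀.b₆)))
    (hη : aeval η (MonicCubic.poly W₀.b₂ (8 * W₀.b₄) (16 * W₀.b₆)) = 0)
    (h3 : Module.finrank ℚ K = 3) :
    ∃ I : ℤ, I ≠ 0 ∧ (2 : ℤ) ^ 8 * W₀.Δ = I ^ 2 * NumberField.discr K := by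
  refine ⟨indexDet (MonicCubic.pb hirr hη h3) (MonicCubic.isIntegral_pb_gen hirr hη h3),
    indexDet_ne_zero _ _, ?_⟩
  have key := (MonicCubic.discr_pb hirr hη h3).symm.trans
    (discr_powerBasis_eq_indexDet_sq_mul_discr (MonicCubic.pb hirr hη h3)
      (MonicCubic.isIntegral_pb_gen hirr hη h3))
  rw [K2b_monic_disc] at key
  exact_mod_cast key

/-! ## K5 — the integral keystone `2⁸ Δ_min = I² |d_K|` (= k3 `exists_index_sq_eq`, verbatim; PROVED) -/

/-- **K5 (PROVED).** k3's N1★ `exists_index_sq_eq` with its registered signature. -/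
theorem K5_exists_index_sq_eq (W : WeierstrassCurve ℚ) [W.IsElliptic] (K : Type) [Field K]
    [NumberField K] (hirr : Irreducible W.twoTorsionPolynomial.toPoly)
    (hdeg : Module.finrank ℚ K = 3) (hθ : ∃ θ : K, aeval θ W.twoTorsionPolynomial.toPoly = 0) :
    ∃ I : ℕ, 0 < I ∧ 2 ^ 8 * W.minimalDiscriminantNorm ℤ = I ^ 2 * (NumberField.discr K).natAbs := by
  obtain ⟨θ, hθ⟩ := hθ
  obtain ⟨C, hC⟩ := WeierstrassCurve.hasGlobalMinimalModel_rat_holds W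
  haveI := hC
  set W₀ := WeierstrassCurve.integralModelInt (C • W) with hW₀
  have hmap : W₀.map (Int.castRingHom ℚ) = C • W := WeierstrassCurve.map_integralModelInt (C • W)
  have hθ' := K1_root_transport W C K hθ
  rw [← hmap] at hθ'
  have hη := K2a_monic_root W₀ K hθ'
  have hirr' := K3_monic_irreducible W C W₀ hmap hirr
  obtain ⟨I, hI0, hI⟩ := K4_index_sq_int W₀ K hirr' hη hdeg
  have hmin : W.minimalDiscriminantNorm ℤ = W₀.Δ.natAbs := by
    rw [← WeierstrassCurve.minimalDiscriminantNorm_smul_rat W C,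
      WeierstrassCurve.minimalDiscriminantNorm_int_eq_natAbs_minimalDiscriminantInt_holds (C • W)]
    rfl
  refine ⟨I.natAbs, Int.natAbs_pos.mpr hI0, ?_⟩
  have h := congrArg Int.natAbs hI
  rw [Int.natAbs_mul, Int.natAbs_mul, Int.natAbs_pow, Int.natAbs_pow] at h
  rw [hmin]
  simpa using h

/-! ## K6 — the ℚ-form `Δ(W) = q² d_K` (= k3 `DiscSqRatio` = k1 g2 H1 = k2 g2 H0; PROVED) -/

/-- **K6 (PROVED).** `Δ(W) = q² · d_K` with `q = u⁶ I / 16 ≠ 0`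
(K4 on the minimal model, Mathlib `variableChange_Δ`, `map_Δ`). This is k3's `DiscSqRatio` unbundled. -/
theorem K6_Δ_eq_sq_mul_discr (W : WeierstrassCurve ℚ) [W.IsElliptic] (K : Type) [Field K]
    [NumberField K] (hirr : Irreducible W.twoTorsionPolynomial.toPoly)
    (hdeg : Module.finrank ℚ K = 3) (hθ : ∃ θ : K, aeval θ W.twoTorsionPolynomial.toPoly = 0) :
    ∃ q : ℚ, q ≠ 0 ∧ W.Δ = q ^ 2 * (NumberField.discr K : ℚ) := by
  obtain ⟨θ, hθ⟩ := hθ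
  obtain ⟨C, hC⟩ := WeierstrassCurve.hasGlobalMinimalModel_rat_holds W
  haveI := hC
  set W₀ := WeierstrassCurve.integralModelInt (C • W) with hW₀
  have hmap : W₀.map (Int.castRingHom ℚ) = C • W := WeierstrassCurve.map_integralModelInt (C • W)
  have hθ' := K1_root_transport W C K hθ
  rw [← hmap] at hθ'
  have hη := K2a_monic_root W₀ K hθ'
  have hirr' := K3_monic_irreducible W C W₀ hmap hirr
  obtain ⟨I, hI0, hI⟩ := K4_index_sq_int W₀ K hirr' hη hdeg
  -- `(C • W).Δ = u⁻¹² Δ(W)` and `(C • W).Δ = W₀.Δ` (cast)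
  have hΔC : (C • W).Δ = (W₀.Δ : ℚ) := by
    have h := W₀.map_Δ (Int.castRingHom ℚ)
    rw [hmap, eq_intCast] at h
    exact h
  have hvar : (C • W).Δ = (↑C.u⁻¹ : ℚ) ^ 12 * W.Δ := WeierstrassCurve.variableChange_Δ W C
  have hu : ((↑C.u : ℚ)) ≠ 0 := C.u.ne_zero
  refine ⟨(↑C.u : ℚ) ^ 6 * I / 16, ?_, ?_⟩
  · have hI0' : (I : ℚ) ≠ 0 := by exact_mod_cast hI0
    positivity
  · have hIQ : (2 : ℚ) ^ 8 * (W₀.Δ : ℚ) = (I : ℚ) ^ 2 * (NumberField.discr K : ℚ) := by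
      exact_mod_cast hI
    have hinv : (↑C.u⁻¹ : ℚ) = (↑C.u : ℚ)⁻¹ := by simp
    rw [hinv] at hvar
    -- W.Δ = u¹² · W₀.Δ = u¹² · I² d_K / 2⁸
    have hW : W.Δ = (↑C.u : ℚ) ^ 12 * (W₀.Δ : ℚ) := by
      rw [← hΔC, hvar]; field_simp
    rw [hW]
    have : (W₀.Δ : ℚ) = (I : ℚ) ^ 2 * (NumberField.discr K : ℚ) / 2 ^ 8 := by
      rw [← hIQ]; ring
    rw [this]; ring

/-! ## K7 — the two hooks the other slots consume, now sorry-free -/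

/-- k3's `IsResolventField` (StubIdeas3ComplexG3Sketch), verbatim. -/
def IsResolventField (W : WeierstrassCurve ℚ) (K : Type) [Field K] [NumberField K] : Prop :=
  Irreducible W.twoTorsionPolynomial.toPoly ∧ Module.finrank ℚ K = 3 ∧
    ∃ θ : K, aeval θ W.twoTorsionPolynomial.toPoly = 0

/-- k3's H1 `DiscSqRatio` (StubIdeas3ComplexG3Sketch), verbatim — the hypothesis of k3's L1
`ordMinDisc_parity` and L2 `dvd_discr_of_odd_ordMinDisc`, hence of k2 g4 `allowanceDvd`. -/
def DiscSqRatio : Prop :=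
  ∀ (W : WeierstrassCurve ℚ) [W.IsElliptic] (K : Type) [Field K] [NumberField K],
    IsResolventField W K → ∃ q : ℚ, q ≠ 0 ∧ W.Δ = q ^ 2 * (NumberField.discr K : ℚ)

/-- **K7a (PROVED).** `DiscSqRatio` holds outright: feed it to k3 L1/L2 and k2 g4 `allowanceDvd`. -/
theorem discSqRatio : DiscSqRatio := fun W _ K _ _ h => K6_Δ_eq_sq_mul_discr W K h.1 h.2.1 h.2.2

/-- **K7b (PROVED) — the sign door** (k2 g4 `discr_neg_iff_Δ_neg`, there conditional on H0):
on the stub's class `d_K < 0 ↔ Δ(W) < 0`, so `stub_complexCubic` is exactly `IndexSzpiro` on `Δ < 0`. -/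
theorem discr_neg_iff_Δ_neg (W : WeierstrassCurve ℚ) [W.IsElliptic] (K : Type) [Field K]
    [NumberField K] (hirr : Irreducible W.twoTorsionPolynomial.toPoly)
    (hdeg : Module.finrank ℚ K = 3) (hθ : ∃ θ : K, aeval θ W.twoTorsionPolynomial.toPoly = 0) :
    NumberField.discr K < 0 ↔ W.Δ < 0 := by
  obtain ⟨q, hq0, hq⟩ := K6_Δ_eq_sq_mul_discr W K hirr hdeg hθ
  have hq2 : (0 : ℚ) < q ^ 2 := by positivity
  rw [hq, mul_neg_iff]
  constructor
  · intro h; exact Or.inl ⟨hq2, by exact_mod_cast h⟩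
  · rintro (⟨-, h⟩ | ⟨h, -⟩)
    · exact_mod_cast h
    · exact absurd hq2 (not_lt.mpr h.le)

end Summit.ABC.ABC.Cruxes.IndexSzpiro.StubIdeasComplexCubic1G5

end
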